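import Summits.BirchSwinnertonDyer.BirchSwinnertonDyer.Theorems.PrintX11aUpperNonSurjFiveExcCoreCycle
import Summits.BirchSwinnertonDyer.BirchSwinnertonDyer.Theorems.PrintX11aUpperNonSurjFiveExcMultiStab
import Summits.BirchSwinnertonDyer.BirchSwinnertonDyer.Theorems.PrintX11aUpperNonSurjFiveExcIhara
import Summits.BirchSwinnertonDyer.BirchSwinnertonDyer.Theorems.PrintX11aUpperNonSurjFiveShaAnIntegralOfPrint
import Literature.NumberTheory.EllipticCurves.IrreducibleModPFrobeniusTraceNeTwoProofs
import HarnessLib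

/-!
# Crux U5 `PrintX11a.UpperNonSurjFive` (item stmt-BirchSwinnertonDyer-20614), line «gl1cartan5», EXCEPTIONAL-ZERO road:
# ★ THE EXCEPTIONAL-ZERO TAMAGAWA DIVISIBILITY «`p ∣ L(E,1)/Ω_E`» at a SPLIT multiplicative prime `p ≥ 5` with `E[p]` irreducible,
# from the EXISTENCE of the level-lowered newform (displayed) and FOUR named facts BY NAME
# (Coleman–Edixhoven, Greenberg–Vatsal, Ihara/Ribet 1984, Mazur 1978)

Cell `bsd-print-x11a`, seat `cruxlead-stmt-BirchSwinnertonDyer-20614` (LEAD g6); `--supports stmt-BirchSwinnertonDyer-20614`,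
closes nothing. File 6 of the EXCEPTIONAL-ZERO road (lead g5's RECOMMENDED NEXT) — the assembly, mirror of the bsd-addord acc2
theorem `KimAtThreeDeepLowerOffStratumLevelLoweringMultiStabRowsRam.stub_nonAdditive_ram_of_exists_levelLoweredNewform` with the
stabilisation prime `q` EQUAL TO THE RESIDUE CHARACTERISTIC `p`:

Let `E/ℚ` (globally minimal `W`) have SPLIT multiplicative reduction at `p ≥ 5` with `E[p]` irreducible, `f ∈ S₂(Γ₀(N))` its
newform (`N = N_E = M₀·D·p`, `p ∤ M₀D`, `D` squarefree and prime to `M₀` — the other multiplicative primes at which `E[p]` is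
unramified —, `a_ℓ(E) = ±1` on `D`), and suppose DISPLAYED the level-lowered NEWFORM: for every `ι : ℚ̄_p ≃ ℂ` a newform
`g ∈ S₂(Γ₀(M₀))` with `a_ℓ(g) ≡ a_ℓ(f)` (`ℓ ∤ Dp`) and `a_ℓ(g) ≡ a_ℓ(f)(ℓ + 1)` (`ℓ ∣ Dp`; at `ℓ = p`: `a_p(g) ≡ p + 1 ≡ 1`) — in print
Ribet 1990 Thm. 1.1 / Darmon–Diamond–Taylor Thm. 3.15 at the optimal level, since `E[p]` is FINITE at `p` (`p ∣ ord_p Δ`, true at every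
non-surjective `p ≥ 5`: Tate). THEN `[0]⁺_f = L(f,1)/Ω⁺_f` is `0` or has `ord_p ≥ 1` (§1), and `L(E,1)/Ω_E`, if non-zero, has `ord_p ≥ 1`
(§2, the Néron period of `W` being a `p`-unit multiple of `Ω⁺_f`: Mazur 1978 Cor. 4.1 / Greenberg–Vatsal Rem. 3.4, tree theorem
`realPeriodRat_eq_unit_mul_plusPeriod_of_multiplicative_of_mazur`). Mechanism: the `k`-fold stabilisation `G` of `g` at `D` (level
`N/p`, `…ExcMultiStab`, Coleman–Edixhoven BY NAME for `α_ℓ ≠ β_ℓ`), then the `p`-STABILISATION `h = ι₁G − β ι_p G ∈ S₂(Γ₀(N))` with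
`β ≡ p ≡ 0`, `α = a_p(G) − β ≡ 1` (`…ExcToolkitRoots`): `aₙ(h) ≡ aₙ(f)` for ALL `n`, Vatsal's Condition 1 for `h`, the old shape
`plusSymbol h = Φ − (β/p)Φ(p·)` with `c = β/p = α⁻¹ ≡ 1`; the canonical-period normalisation `Ω` of `Φ = plusSymbol G` (`…ExcPeriod`,
any level, at the Chebotarev prime `r₀ ≡ 1 (mod N)` with `p ∤ a_{r₀}(E) − 2`, tree theorem
`exists_prime_modEq_one_not_dvd_frobeniusTrace_sub_two` from `E[p]` irreducible) and its Ihara non-degeneracy (`…ExcIhara`,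
`ribet1984_iharaLemma` BY NAME); Greenberg–Vatsal 2000 BY NAME for the pair `(f, h)` at level `N ∋ p` and the cycle core
(`…ExcCoreCycle`): `[0]⁺_f ≡ u·(1 − c)·Φ(0)/Ω ≡ 0`. Theorems only; no definition, no named fact, no `sorry`; nothing about any curve is
asserted unconditionally (four named facts + the displayed newform); BSD is not proved by any of this.

* §1 ★ `one_le_padicValRat_ratPlusSymbol_zero_of_exists_levelLoweredNewform`.
* §2 ★ `one_le_padicValRat_LOne_div_realPeriod_of_exists_levelLoweredNewform` (+ Mazur 1978 Cor. 4.1 BY NAME).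

## References

* K. A. Ribet, Invent. Math. 100 (1990), Thm. 1.1 [Ribet1990]; H. Darmon, F. Diamond, R. Taylor, *Fermat's Last Theorem* (1995),
  Thm. 3.15, Prop. 2.12, Thm. 3.1 [DarmonDiamondTaylor1995]; K. A. Ribet, Proc. ICM 1983 (1984), Thm. 4.1 [Ribet1984ICM];
  V. Vatsal, Duke Math. J. 98 (1999), §1 [Vatsal1999]; R. Greenberg, V. Vatsal, Invent. Math. 142 (2000), §3 (17)–(19), Rem. 3.4,
  Lemma (3.6) [GreenbergVatsal2000]; R. F. Coleman, B. Edixhoven, Math. Ann. 310 (1998), Thm. 2.1 [ColemanEdixhoven1998]; B. Mazur,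
  Invent. Math. 44 (1978), Cor. 4.1 [Mazur1978]; B. Mazur, J. Tate, J. Teitelbaum, Invent. Math. 84 (1986), §I.8
  [MazurTateTeitelbaum1986Invent]; J. Tate, in Cassels–Fröhlich (1967), Ch. VII §2.4 [TateGCFT1967].
-/

set_option autoImplicit false
-- the Theorems namespace of a single-conjunct summit repeats the summit name by design (D-0017)
set_option linter.dupNamespace false

noncomputable section

open scoped MatrixGroups ModularForm Classical NNReal

open CongruenceSubgroup WeierstrassCurve Literature.NumberTheory.EllipticCurves
  Literature.NumberTheory.EllipticCurves.ModularForms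
open UpperHalfPlane hiding I

namespace Summit.BirchSwinnertonDyer.BirchSwinnertonDyer.Theorems.GL1Cartan.Exc

open Summit.BirchSwinnertonDyer.BirchSwinnertonDyer.Theorems.KimAtThreeDeepLowerOffStratumLevelLoweringConditionOne
  (hasSimpleHeckeGenEigenspace_of_isNewform0)
open Summit.BirchSwinnertonDyer.BirchSwinnertonDyer.Theorems.KimAtThreeDeepLowerOffStratumLevelLoweringVatsalStab
  (cuspCoeff_stab isNormalized_stab plusSymbol_stab)
open Summit.BirchSwinnertonDyer.BirchSwinnertonDyer.Theorems.KimAtThreeDeepLowerOffStratumLevelLoweringVatsalStabRows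
  (lFunction_eq_one_of_hasSplitMultiplicativeReductionAtPrime)
open Summit.BirchSwinnertonDyer.BirchSwinnertonDyer.Theorems.KimAtThreeDeepLowerOffStratumLevelLoweringStabEigenform
  renaming heckeT_stab_of_ne → heckeT_stab_of_ne_eig, heckeT_stab_self → heckeT_stab_self_eig,
    isHeckeEigenform_stab → isHeckeEigenform_stab_eig, cuspCoeff_stab_prime → cuspCoeff_stab_prime_eig,
    cuspCoeff_mul_cuspCoeff → cuspCoeff_mul_cuspCoeff_eig, heckeEigenvalue_stab → heckeEigenvalue_stab_eig,
    valuation_cuspCoeff_stab_le_one → valuation_cuspCoeff_stab_le_one_three,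
    finiteDimensional_coeffField_stab → finiteDimensional_coeffField_stab_eig
open Summit.BirchSwinnertonDyer.BirchSwinnertonDyer.Theorems.KimAtThreeDeepLowerOffStratumLevelLoweringMultiStabConditionOne
  (hasSimpleHeckeGenEigenspace_stab_of_hasSimpleHeckeGenEigenspace)

/-! ### §1 ★ `[0]⁺_f ≡ 0 (mod p)` from the existence of the level-lowered newform -/

section Symbol

/-- ★ **`[0]⁺_f = 0` or `1 ≤ ord_p [0]⁺_f` at a SPLIT multiplicative `p ≥ 5` with `E[p]` irreducible, from the DISPLAYED
level-lowered newform and three named facts BY NAME** (Coleman–Edixhoven `hCE`, Greenberg–Vatsal `hGV`, Ihara/Ribet 1984 `hI`).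
Binders: `W` globally minimal, split multiplicative at `p ≥ 5`, `E[p]` irreducible; `N = N_E = M₀·D·p` with `p ∤ M₀D`, `D`
squarefree and prime to `M₀`, `a_ℓ(f) = ±1` on `D`; `f` the newform of `W` at level `N`; and for every `ι : ℚ̄_p ≃ ℂ` a NEWFORM
`g ∈ S₂(Γ₀(M₀))` with `a_ℓ(g) ≡ a_ℓ(f)` (`ℓ ∤ Dp`), `a_ℓ(g) ≡ a_ℓ(f)(ℓ + 1)` (`ℓ ∣ Dp`). See the module docstring for the mechanism.
[cite: GreenbergVatsal2000, §3 (17)–(19) and Lemma (3.6)] [cite: Vatsal1999, §1 (1.6), Remark (1.12), Thm. (1.13)]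
[cite: Ribet1984ICM, Thm. 4.1] [cite: ColemanEdixhoven1998, Thm. 2.1] [cite: Ribet1990, Thm. 1.1]
[cite: TateGCFT1967, §2.4 (Tchebotarev density theorem)] -/
theorem one_le_padicValRat_ratPlusSymbol_zero_of_exists_levelLoweredNewform
    (hCE : colemanEdixhoven1998_heckePolynomial_simpleRoots)
    (hGV : greenbergVatsal2000_plusSymbol_congruence) (hI : ribet1984_iharaLemma)
    (W : WeierstrassCurve ℚ) [W.IsElliptic] [W.IsGloballyMinimal] {p : ℕ} [Fact p.Prime] (hp5 : 5 ≤ p)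
    (hsplit : W.HasSplitMultiplicativeReductionAtPrime p) (hirr : W.HasIrreducibleModPGaloisRep p)
    {N : ℕ} [NeZero N] (hN : N = W.conductorNorm ℤ) {f : CuspForm (Gamma0 N) 2} (hf : IsNewformOf W f)
    {M₀ D : ℕ} [NeZero M₀] (hMD : M₀ * D * p = N) (hpMD : ¬ p ∣ M₀ * D) (hDsq : Squarefree D)
    (hDM₀ : Nat.Coprime D M₀)
    (hsign : ∀ ℓ : ℕ, ℓ.Prime → ℓ ∣ D → ∃ u : ℤ, u * u = 1 ∧ cuspCoeff f ℓ = u)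
    (hex : ∀ ι : PadicAlgCl p ≃+* ℂ, ∃ g : CuspForm (Gamma0 M₀) 2, IsNewform0 g ∧
      (∀ ℓ : ℕ, ℓ.Prime → ¬ ℓ ∣ D * p → Valued.v (ι.symm (cuspCoeff f ℓ - cuspCoeff g ℓ)) < 1) ∧
      (∀ ℓ : ℕ, ℓ.Prime → ℓ ∣ D * p → Valued.v (ι.symm (cuspCoeff g ℓ - cuspCoeff f ℓ * (ℓ + 1))) < 1)) :
    ratPlusSymbol f 0 ≠ 0 → 1 ≤ padicValRat p (ratPlusSymbol f 0) := by
  subst hMD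
  have hp : p.Prime := Fact.out
  have hp2 : p ≠ 2 := by omega
  haveI : NeZero p := ⟨hp.ne_zero⟩
  haveI : NeZero D := ⟨Squarefree.ne_zero hDsq⟩
  have hpM₀ : ¬ p ∣ M₀ := fun h ↦ hpMD (h.mul_right D)
  have hpD : ¬ p ∣ D := fun h ↦ hpMD (h.mul_left M₀)
  have hpN : ¬ p ^ 2 ∣ M₀ * D * p := by
    rintro ⟨k, hk⟩
    apply hpMD
    refine ⟨k, ?_⟩
    have : M₀ * D * p = (p * k) * p := by rw [hk]; ring
    exact Nat.eq_of_mul_eq_mul_right hp.pos this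
  have h5 : 5 ≤ M₀ * D * p := by
    have hpos : 0 < M₀ * D := Nat.pos_of_ne_zero (mul_ne_zero (NeZero.ne M₀) (NeZero.ne D))
    nlinarith
  have hmult : W.HasMultiplicativeReductionAtPrime p := hsplit.hasMultiplicativeReductionAtPrime
  set ι : PadicAlgCl p ≃+* ℂ := Classical.choice (PadicAlgCl.nonempty_ringEquiv_complex p) with hι
  obtain ⟨g, hg, hcp, hrem⟩ := hex ι
  have hfp : cuspCoeff f p = 1 := by
    rw [hf.2 p, lFunction_eq_one_of_hasSplitMultiplicativeReductionAtPrime W p hsplit, Int.cast_one]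
  -- the `k`-fold stabilisation `G` of `g` at the primes of `D` (level `M₀ D = N/p`)
  obtain ⟨G, hGeig, hGnorm, hGint, hGfd, hGC, hGg, hGf, hGspan⟩ :=
    exists_multiStab hg ι (fun ℓ ↦ cuspCoeff f ℓ) hCE D hDsq hDM₀
      (fun ℓ hℓ hℓD ↦ by
        obtain ⟨u, hu, hfu⟩ := hsign ℓ hℓ hℓD
        refine ⟨u, hu, hfu, ?_⟩
        have h := hrem ℓ hℓ (hℓD.mul_right p)
        rwa [hfu] at h)
      (M₀ * D) rfl
  have hGp : ∀ {ℓ : ℕ}, ℓ.Prime → ¬ ℓ ∣ M₀ * D → cuspCoeff G ℓ = cuspCoeff g ℓ :=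
    fun {ℓ} hℓ hℓL ↦ hGg ℓ hℓ fun h ↦ hℓL (h.mul_left M₀)
  -- the `p`-stabilisation: the root `β ≡ p ≡ 0`, `α = a_p(G) − β ≡ 1`, `α ≠ β` (Coleman–Edixhoven), `c = β/p ≡ 1`
  have hGq : cuspCoeff G p = cuspCoeff g p := hGg p hp hpD
  have haq : Valued.v (ι.symm (cuspCoeff G p - (p + 1))) < 1 := by
    have h := hrem p hp (dvd_mul_left p D)
    rwa [hfp, one_mul, ← hGq] at h
  have haq' : Valued.v (ι.symm (cuspCoeff G p - (1 : ℤ) * (p + 1))) < 1 := by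
    simpa only [Int.cast_one, one_mul] using haq
  obtain ⟨β, hβ, hβq, -⟩ := exists_root_valuation_sub_lt_one_sign ι (hGint p) p (u := 1) (by norm_num) haq'
  have hβq' : Valued.v (ι.symm (β - p)) < 1 := by simpa only [Int.cast_one, one_mul] using hβq
  have hne : cuspCoeff G p - β ≠ β :=
    colemanEdixhoven1998_heckePolynomial_simpleRoots.root_ne hCE hg hp hpM₀ (by rw [← hGq]; exact sub_add_cancel _ β)
      (by linear_combination -hβ)
  obtain ⟨hα1, hc⟩ := valuation_div_sub_one_lt_one ι hp hβ haq hβq'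
  -- the comparison form `h = ι₁ G − β ι_p G` at level `M₀ D p = N`
  have hq₁ : M₀ * D * 1 ∣ M₀ * D * p := mul_dvd_mul_left _ (one_dvd p)
  have hqq : M₀ * D * p ∣ M₀ * D * p := dvd_rfl
  set h := iota (M₀ * D) (M₀ * D * p) 1 2 hq₁ G - β • iota (M₀ * D) (M₀ * D * p) p 2 hqq G with hhdef
  have heig : IsHeckeEigenform h := isHeckeEigenform_stab_eig hGeig hGnorm β hq₁ hqq hp hpMD hβ
  have hnorm : IsNormalized h := isNormalized_stab G β hq₁ hqq hGnorm hp
  have hhint : ∀ n, Valued.v (ι.symm (cuspCoeff h n)) ≤ 1 := valuation_cuspCoeff_stab_le_one ι β hq₁ hqq hGint hβ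
  have hhfd : FiniteDimensional ℚ (coeffField h) := finiteDimensional_coeffField_stab_eig β hq₁ hqq hGfd hβ
  have hhC : HasSimpleHeckeGenEigenspace h :=
    hasSimpleHeckeGenEigenspace_stab_of_hasSimpleHeckeGenEigenspace hg hq₁ hqq (dvd_mul_right M₀ D) hGeig hGnorm hGC
      (fun ℓ hℓ hℓL ↦ hGp hℓ hℓL) hp hpMD hβ hne
  -- congruence of ALL coefficients, from the primes
  have hcong : ∀ n : ℕ, Valued.v (ι.symm (cuspCoeff f n - cuspCoeff h n)) < 1 := by
    refine valuation_cuspCoeff_sub_lt_one_of_prime ι hf.1.2.1 heig hf.1.2.2 hnorm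
      (valuation_cuspCoeff_le_one_of_isNewformOf hf ι) hhint fun ℓ hℓ ↦ ?_
    rw [hhdef, cuspCoeff_stab_prime_eig hGnorm β hq₁ hqq hp hℓ]
    by_cases hℓp : ℓ = p
    · subst hℓp
      rw [if_pos rfl, hfp]
      have : ι.symm (1 - (cuspCoeff G ℓ - β)) = -ι.symm (cuspCoeff G ℓ - β - 1) := by rw [← map_neg]; congr 1; ring
      rw [this, Valuation.map_neg]; exact hα1
    · rw [if_neg hℓp]
      by_cases hℓD : ℓ ∣ D
      · exact hGf ℓ hℓ hℓD
      · have hℓDp : ¬ ℓ ∣ D * p := fun h' ↦ by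
          rcases (Nat.Prime.dvd_mul hℓ).mp h' with h' | h'
          · exact hℓD h'
          · exact hℓp ((Nat.prime_dvd_prime_iff_eq hℓ hp).mp h')
        rw [hGg ℓ hℓ hℓD]; exact hcp ℓ hℓ hℓDp
  -- the OLD SHAPE `plusSymbol h = Φ − (β/p)Φ(p·)`, `Φ = plusSymbol G`
  have hshape : ∀ x : ℚ, plusSymbol h x = plusSymbol G x - β / p * plusSymbol G (p * x) :=
    fun x ↦ plusSymbol_stab G β hq₁ hqq x
  -- the Chebotarev numeral `r₀ ≡ 1 (mod N)` with `p ∤ a_{r₀}(E) − 2`, from `E[p]` irreducible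
  obtain ⟨r₀, hr₀, -, -, -, hr₀S, hr₀1, hE₂⟩ :=
    exists_prime_modEq_one_not_dvd_frobeniusTrace_sub_two W p hp2 hirr (M₀ * D * p) ∅ Set.finite_empty
  haveI : Fact r₀.Prime := ⟨hr₀⟩
  have hr₀L : ¬ r₀ ∣ M₀ * D := fun h' ↦ hr₀S (h'.mul_right p)
  have hr₀1L : r₀ ≡ 1 [MOD M₀ * D] := hr₀1.of_mul_right p
  have hr₀Dp : ¬ r₀ ∣ D * p := fun h' ↦ hr₀S ((mul_assoc M₀ D p).symm ▸ h'.mul_left M₀)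
  have hr₀N : ¬ r₀ ∣ W.conductorNorm ℤ := by rwa [← hN]
  have hE₀ : ¬ (p : ℤ) ∣ W.frobeniusTrace r₀ - (r₀ + 1) := by
    intro hdvd
    have h1p : (p : ℤ) ∣ (1 : ℕ) - (r₀ : ℤ) := (hr₀1.of_mul_left (M₀ * D)).dvd
    apply hE₂
    have : W.frobeniusTrace r₀ - 2 = (W.frobeniusTrace r₀ - (r₀ + 1)) - ((1 : ℕ) - (r₀ : ℤ)) := by push_cast; ring
    rw [this]
    exact dvd_sub hdvd h1p
  have hfr₀ : cuspCoeff f r₀ = (W.frobeniusTrace r₀ : ℂ) := by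
    rw [hf.2 r₀, LFunction_apply_prime_eq_frobeniusTrace W r₀ (hasGoodReductionAtPrime_of_not_dvd_conductorNorm W hr₀N)]
  have hE₀f : Valued.v (ι.symm (cuspCoeff f r₀ - (r₀ + 1))) = 1 :=
    valuation_cuspCoeff_sub_eq_one_of_congr ι hE₀ (by rw [hfr₀, sub_self, map_zero, Valuation.map_zero]; exact zero_lt_one)
  have hunit : Valued.v (ι.symm (cuspCoeff g r₀ - (r₀ + 1))) = 1 := by
    refine valuation_cuspCoeff_sub_eq_one_of_congr ι hE₀ ?_
    rw [← hfr₀]; exact hcp r₀ hr₀ hr₀Dp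
  -- the real structure of `G`: `G = Σ cᵢ φᵢ`, `φᵢ` real with `T_r φᵢ = a_r(g) φᵢ` (`r ∤ M₀D`)
  obtain ⟨n, cc, φ, hGsum⟩ := Submodule.mem_span_set'.mp hGspan
  have hreal : ∀ i m, (cuspCoeff (φ i : CuspForm (Gamma0 (M₀ * D)) 2) m).im = 0 := fun i ↦ (φ i).2.1
  have hφT : ∀ (i : Fin n) (r : ℕ) (hr : r.Prime), ¬ r ∣ M₀ * D * p →
      (haveI : NeZero r := ⟨hr.ne_zero⟩; heckeT (Gamma0 (M₀ * D)) 2 r (φ i : CuspForm (Gamma0 (M₀ * D)) 2)) =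
        cuspCoeff g r • (φ i : CuspForm (Gamma0 (M₀ * D)) 2) :=
    fun i r hr hrS ↦ (φ i).2.2 r hr fun h' ↦ hrS (h'.mul_right p)
  have he : ∀ r : ℕ, r.Prime → ¬ r ∣ M₀ * D * p → IsIntegral ℤ (cuspCoeff g r) ∧ (cuspCoeff g r).im = 0 :=
    fun r _ _ ↦ ⟨IsNewform0.isIntegral_coeff_holds hg r, hg.cuspCoeff_im_eq_zero r⟩
  have hTG : ∀ (r : ℕ) (hr : r.Prime), ¬ r ∣ M₀ * D →
      (haveI : NeZero r := ⟨hr.ne_zero⟩; heckeT (Gamma0 (M₀ * D)) 2 r G) = cuspCoeff g r • G := by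
    intro r hr hrL
    haveI : NeZero r := ⟨hr.ne_zero⟩
    rw [heckeT_eq_heckeEigenvalue_smul G r (hGeig r hr), heckeEigenvalue_eq_coeff_of_isNormalized hGnorm hr (hGeig r hr),
      ← hGp hr hrL]
    rfl
  -- the period producer (any level) and Ihara: `plusSymbol h ≢ 0 ⟹ Ψ ≢ 0 ⟹ Ω ⟹ x₀`
  have hΩ : (∃ x : ℚ, plusSymbol h x ≠ 0) →
      ∃ Ω : ℂ, (∀ x : ℚ, Valued.v (ι.symm (plusSymbol G x / Ω)) ≤ 1) ∧
        ∃ x₀ : ℚ, Valued.v (ι.symm ((plusSymbol G x₀ - β / p * plusSymbol G (p * x₀)) / Ω)) = 1 := by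
    rintro ⟨x, hx⟩
    have hne0 : ∃ y : ℚ, plusSymbol (∑ i, cc i • (φ i : CuspForm (Gamma0 (M₀ * D)) 2)) y ≠ 0 := by
      by_contra hall
      push Not at hall
      rw [hGsum] at hall
      exact hx (by rw [hshape, hall, hall, mul_zero, sub_zero])
    have hTsum := hTG r₀ hr₀ hr₀L
    rw [← hGsum] at hTsum
    obtain ⟨Ω, hΩint, γ₀, hγ₀, hΩu⟩ := exists_period_integral_unit_cycle_sum_smul_of_one_mod (c := cc) ι hreal hne0 hr₀
      hr₀L hr₀1L (valuation_cuspCoeff_le_one_of_isNewform0 hg ι r₀) hTsum hunit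
    obtain ⟨x₀, hx₀⟩ := exists_valuation_stabilisedSymbol_eq_one_sum_smul_of_ribet1984_iharaLemma hI hp hpMD hφT he hreal
      cc ι hp2 hΩint γ₀ hγ₀ hΩu hr₀ hr₀S hr₀1 hunit hc
    rw [hGsum] at hΩint hx₀
    exact ⟨Ω, hΩint, x₀, hx₀⟩
  -- Greenberg–Vatsal BY NAME + the cycle core
  exact one_le_padicValRat_ratPlusSymbol_zero_of_greenbergVatsal_cycle hGV W hf ι hp2 hpN h5 hmult hirr hr₀ hr₀S hr₀1 hE₀f
    heig hnorm hhfd hhint hhC hcong p (plusSymbol G) (β / p) hshape hc hΩ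

end Symbol

/-! ### §2 ★ The exceptional-zero Tamagawa divisibility `p ∣ L(E,1)/Ω_E` -/

section LValue

/-- ★ **THE EXCEPTIONAL-ZERO TAMAGAWA DIVISIBILITY** — at a SPLIT multiplicative prime `p ≥ 5` with `E[p]` irreducible, GIVEN the
level-lowered newform (displayed; in print it exists because `E[p]` is finite at `p`, `p ∣ ord_p Δ = c_p`): if `L(E,1)/Ω_E = t ∈ ℚ`
with `t ≠ 0` then `1 ≤ ord_p t`, i.e. **`p` divides `L(E,1)/Ω_E`** — as BSD predicts from `p ∣ c_p` and `p ∤ #E(ℚ)_tors`.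
From §1 (`[0]⁺_f ≡ 0`) and `Ω_E = u·Ω⁺_f`, `|u|_p = 1` (Mazur 1978 Cor. 4.1 BY NAME `hMz`, through the tree theorem
`realPeriodRat_eq_unit_mul_plusPeriod_of_multiplicative_of_mazur`; `L(E,1) = [0]⁺_f·Ω⁺_f`). FIVE named facts
(`hCE hGV hI hMz` + the displayed newform). [cite: Mazur1978, Cor. 4.1] [cite: GreenbergVatsal2000, §3 (17)–(19), Remark 3.4]
[cite: Vatsal1999, §1 (1.6), Thm. (1.13)] [cite: Ribet1984ICM, Thm. 4.1] [cite: ColemanEdixhoven1998, Thm. 2.1]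
[cite: MazurTateTeitelbaum1986Invent, §I.8] -/
theorem one_le_padicValRat_LOne_div_realPeriod_of_exists_levelLoweredNewform
    (hCE : colemanEdixhoven1998_heckePolynomial_simpleRoots)
    (hGV : greenbergVatsal2000_plusSymbol_congruence) (hI : ribet1984_iharaLemma)
    (hMz : mazur_not_dvd_maninConstant_of_odd)
    (W : WeierstrassCurve ℚ) [W.IsElliptic] [W.IsGloballyMinimal] {p : ℕ} [Fact p.Prime] (hp5 : 5 ≤ p)
    (hsplit : W.HasSplitMultiplicativeReductionAtPrime p) (hirr : W.HasIrreducibleModPGaloisRep p)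
    {N : ℕ} [NeZero N] (hN : N = W.conductorNorm ℤ) {f : CuspForm (Gamma0 N) 2} (hf : IsNewformOf W f)
    {M₀ D : ℕ} [NeZero M₀] (hMD : M₀ * D * p = N) (hpMD : ¬ p ∣ M₀ * D) (hDsq : Squarefree D)
    (hDM₀ : Nat.Coprime D M₀)
    (hsign : ∀ ℓ : ℕ, ℓ.Prime → ℓ ∣ D → ∃ u : ℤ, u * u = 1 ∧ cuspCoeff f ℓ = u)
    (hex : ∀ ι : PadicAlgCl p ≃+* ℂ, ∃ g : CuspForm (Gamma0 M₀) 2, IsNewform0 g ∧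
      (∀ ℓ : ℕ, ℓ.Prime → ¬ ℓ ∣ D * p → Valued.v (ι.symm (cuspCoeff f ℓ - cuspCoeff g ℓ)) < 1) ∧
      (∀ ℓ : ℕ, ℓ.Prime → ℓ ∣ D * p → Valued.v (ι.symm (cuspCoeff g ℓ - cuspCoeff f ℓ * (ℓ + 1))) < 1)) :
    ∀ t : ℚ, W.entireLFunction 1 / (W.realPeriodRat : ℂ) = (t : ℂ) → t ≠ 0 → 1 ≤ padicValRat p t := by
  intro t ht ht0
  have hmult : W.HasMultiplicativeReductionAtPrime p := hsplit.hasMultiplicativeReductionAtPrime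
  obtain ⟨u, hu, hΩ⟩ :=
    SkinnerUrban2014.realPeriodRat_eq_unit_mul_plusPeriod_of_multiplicative_of_mazur hMz W p hp5 hmult hirr f hf
  have hΩpos : 0 < W.realPeriodRat := W.realPeriodRat_pos_holds
  have hΩC : (W.realPeriodRat : ℂ) ≠ 0 := Complex.ofReal_ne_zero.mpr hΩpos.ne'
  have hu0 : u ≠ 0 := by
    rintro rfl
    rw [Rat.cast_zero, zero_mul] at hΩ
    exact hΩpos.ne' hΩ
  have hLval : W.entireLFunction 1 = ((((ratPlusSymbol f 0 : ℚ) : ℝ) * plusPeriod f : ℝ) : ℂ) := hf.entireLFunction_one_eq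
  have hplus : plusPeriod f = W.realPeriodRat / u := by
    rw [hΩ, mul_div_cancel_left₀ _ (Rat.cast_ne_zero.mpr hu0)]
  have ht' : W.entireLFunction 1 / (W.realPeriodRat : ℂ) = ((ratPlusSymbol f 0 / u : ℚ) : ℂ) := by
    rw [hLval, hplus, div_eq_iff hΩC]
    push_cast
    have huC : ((u : ℝ) : ℂ) ≠ 0 := by exact_mod_cast hu0
    field_simp
  have hteq : t = ratPlusSymbol f 0 / u := by
    have h : ((t : ℚ) : ℂ) = ((ratPlusSymbol f 0 / u : ℚ) : ℂ) := by rw [← ht, ht']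
    exact_mod_cast h
  have hb0 : ratPlusSymbol f 0 ≠ 0 := by
    intro h0
    apply ht0
    rw [hteq, h0, zero_div]
  have hb : 1 ≤ padicValRat p (ratPlusSymbol f 0) :=
    one_le_padicValRat_ratPlusSymbol_zero_of_exists_levelLoweredNewform hCE hGV hI W hp5 hsplit hirr hN hf hMD hpMD hDsq
      hDM₀ hsign hex hb0
  rw [hteq, padicValRat.div hb0 hu0, Rank1Residual.padicValRat_eq_zero_of_norm_ratCast_eq_one hu, sub_zero]
  exact hb

end LValue

end Summit.BirchSwinnertonDyer.BirchSwinnertonDyer.Theorems.GL1Cartan.Exc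

end
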